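import Summits.BirchSwinnertonDyer.BirchSwinnertonDyer.Theorems.EisensteinPrimesCharResidualSelmerKummer
import Summits.BirchSwinnertonDyer.BirchSwinnertonDyer.Theorems.CumulativeHeegnerLeopoldtCumulativeHeegnerInclusionAtThreeBadPlacesSplitFinite
import Summits.BirchSwinnertonDyer.BirchSwinnertonDyer.Theorems.CumulativeHeegnerLeopoldtCumulativeHeegnerInclusionAtThreeStubResidualSelmerFiniteDevissageNamed
import Summits.BirchSwinnertonDyer.Rank1Residual.X2.ResidualDevissageModules
import Literature.NumberTheory.EllipticCurves.GoodReductionUnramifiedProofs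
import Literature.NumberTheory.GaloisRepresentations.DecompositionGroupOfCompletion
import HarnessLib

/-!
# Route `EisensteinPrimes`, crux 2 `GoodLatticeBDPValue` (stmt-BirchSwinnertonDyer-19032), line `halves` v20.1, stub
# `stub_indexInputs`: **the four (U) conjuncts — unramified transport at the good places** (Néron–Ogg–Shafarevich)

Cell `bsd-eis` (home `run/shared/lean/pub/bsd-eis/`), width seat `bsd-line-x1-p1-w6` («width 6»; `--supports -19032`,
closes nothing). In the registered skeleton `Cruxes/GoodLatticeBDPValue/Lines/halves.lean` (v20.1, a012386a…) the
conjuncts `hUi hU₁ hU₂ hU₃` of `stub_indexInputs` ask, at every good place `w ∉ Sf`, `w ∤ p` of `K`, for the injectivity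
of the change-of-coefficients maps on the INERTIA cohomology of `K_∞ = K̄^{ker κ}`,
`H¹(ker κ ⊓ I_w, N) → H¹(ker κ ⊓ I_w, A)` (`resH1Hom (ContinuousMonoidHom.id (inertiaIn κ.kerSubgroup w)) f _`), for the
four equivariant embeddings `f ∈ {Φ.incl : Φ ↪ E_K[p], j₁ : Φ ↪ (F/𝒪)(θsub), E_K[p] ↪ E_K[p^∞], j₃ : E_K[p]/Φ ↪ (F/𝒪)(θquot)}`
— the (U) hypotheses of `ResidualIndexAssembly.zpCorank_datumStrictSelmer_add_eq` (KY Lemma 1.2.4 / V21 step (2) at the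
`U`-level: «unramified for `N` ⟺ unramified for `A`»). This file proves them by name, universally over the data:

* §1 generic: if `G` acts TRIVIALLY on `B` then `j_* : H¹(G, A) → H¹(G, B)` is injective for every injective equivariant
  `j : A → B` — the tree's `CumulativeHeegnerInclusionAtThreeStubB1DevissageNamed.resH1Hom_id_injective_of_smul_eq` (reused).
* §2 `hasGoodReductionAt_of_not_mem` — `w ∉ Sf` (`Sf` = the places over `N_E`), `w ∤ p` ⟹ `E_K` has good reduction at `w`
  (`exists_prime_mem_dvd_conductorNorm_of_not_hasGoodReductionAt`); `smul_primaryTorsion_eq_of_mem_inertia`,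
  `smul_torsion_eq_of_mem_inertia` — Néron–Ogg–Shafarevich (Silverman VII.4.1 (a),
  `smul_eq_of_mem_inertia_of_nsmul_eq_zero`): `I_w = GreenbergSelmer.inertia w` fixes `E_K[p^∞]` and `E_K[p]`;
  hence every `g : inertiaIn H w` does (any `H`).
* §3 the four conjuncts in the skeleton's exact shapes, for ANY `H ≤ Γ_K` (so `H = κ.kerSubgroup`):
  **`injective_resH1Hom_inertiaIn_incl`** (`hUi`), **`injective_resH1Hom_inertiaIn_inclusion`** (`hU₂`) by §1–§2;
  **`injective_resH1Hom_inertiaIn_of_charModule`** (`hU₁`/`hU₃`, any equivariant `j : N ↪ (F/𝒪)(θ)` onto the `p`-torsion of a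
  Teichmüller character `θ`, NO reduction hypothesis: w4 gen 3's Kummer criterion `resH1Hom_id_injective_of_invariants_divisible`
  fed by `charModule_invariants_divisible` at the `inertiaIn` action).

HONEST FRAMING: helper theorems only (0 definitions, 0 named facts, 0 sorry); no summit statement, no BSD / IMC2 / KY
Thm 1.4.1 (iii) is proved; 0 stubs / cells / labels move. References: [SilvermanAEC2009] VII.4.1 (a); [KellerYin2024] Lemma 1.2.4,
§1.4 (arXiv:2402.12781v2 TeX L760–778, L1178–1330); [SerreGaloisCohomology1997] I.§2.2.
-/

set_option autoImplicit false
-- the route's Theorems namespace repeats the summit name by design (D-0017 nested layout)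
set_option linter.dupNamespace false

noncomputable section

open scoped Classical Pointwise

namespace Summit.BirchSwinnertonDyer.BirchSwinnertonDyer.Theorems.IndexInputsH0

open NumberField IsDedekindDomain Field WeierstrassCurve
  Literature.NumberTheory.EllipticCurves Literature.NumberTheory.EllipticCurves.GreenbergSelmer
  Literature.NumberTheory.GaloisRepresentations Literature.NumberTheory.EllipticCurves.KellerYin2024
  Summit.BirchSwinnertonDyer.Rank1Residual.X2.ResidualDevissageModules
  Summit.BirchSwinnertonDyer.BirchSwinnertonDyer.Theorems.CumulativeHeegnerInclusionAtThreeBadPlaces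

/-! ## §1. Injectivity of `j_*` under a trivial action on the target

This is the tree's `CumulativeHeegnerInclusionAtThreeStubB1DevissageNamed.resH1Hom_id_injective_of_smul_eq`
(CHL K1 lead, «typical use: `G` an inertia group at a place of good reduction, `B = E[p]`») — reused, not restated. -/

/-! ## §2. Good reduction off `Sf ∪ {w ∣ p}` and Néron–Ogg–Shafarevich on `E_K[p^∞]` -/

section NOS

variable (W : WeierstrassCurve ℚ) [W.IsElliptic] {p : ℕ} {K : Type} [Field K] [NumberField K]

/-- **Good reduction at `w ∉ Sf`, `w ∤ p`** when `Sf` is the set of places of `K` over the conductor `N_E`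
(`w ∈ Sf ↔ (N_E) ⊆ w`): a place of bad reduction of `E_K` lies over a prime `ℓ ∣ N_E`. [cite: SilvermanAEC2009, VII.§5 and VIII.§1] -/
theorem hasGoodReductionAt_of_not_mem (Sf : Finset (HeightOneSpectrum (𝓞 K)))
    (hSf : ∀ w : HeightOneSpectrum (𝓞 K), w ∈ Sf ↔ ((W.conductorNorm ℤ : ℤ) : 𝓞 K) ∈ w.asIdeal)
    {w : HeightOneSpectrum (𝓞 K)} (hw : w ∉ (↑Sf : Set (HeightOneSpectrum (𝓞 K)))) :
    (W.baseChange K).HasGoodReductionAt w := by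
  by_contra hbad
  obtain ⟨ℓ, -, hℓw, hℓN⟩ := exists_prime_mem_dvd_conductorNorm_of_not_hasGoodReductionAt W K w hbad
  apply hw
  rw [Finset.mem_coe, hSf]
  obtain ⟨m, hm⟩ := hℓN
  rw [hm, Nat.cast_mul, Int.cast_mul, Int.cast_natCast]
  exact w.asIdeal.mul_mem_right _ hℓw

/-- **Néron–Ogg–Shafarevich on `E_K[p^∞]`**: at a place `w ∤ p` of good reduction the inertia group
`I_w = GreenbergSelmer.inertia w` fixes every point of `E_K[p^∞]` (Silverman VII.4.1 (a) at `n = p^k`).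
[cite: SilvermanAEC2009, Prop. VII.4.1(a)] -/
theorem smul_primaryTorsion_eq_of_mem_inertia {w : HeightOneSpectrum (𝓞 K)}
    (hgood : (W.baseChange K).HasGoodReductionAt w) (hpw : ((p : ℕ) : 𝓞 K) ∉ w.asIdeal)
    {τ : absoluteGaloisGroup K} (hτ : τ ∈ GreenbergSelmer.inertia w)
    (x : ↥((W.baseChange K).geomPrimaryTorsion p)) : τ • x = x := by
  haveI hEK : (W.baseChange K).IsElliptic := inferInstanceAs (W.map (algebraMap ℚ K)).IsElliptic
  have e : GreenbergSelmer.inertia w = (adicCompletionPrime K w).inertia (absoluteGaloisGroup K) :=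
    (inertia_adicCompletionPrime_eq_map_absInertia K w).symm
  rw [e] at hτ
  obtain ⟨k, hk⟩ := x.2
  have hpk : ((p ^ k : ℕ) : 𝓞 K) ∉ w.asIdeal := by
    rw [Nat.cast_pow]
    exact fun h ↦ hpw (w.isPrime.mem_of_pow_mem k h)
  apply Subtype.ext
  rw [primaryComponent.coe_smul]
  exact (W.baseChange K).smul_eq_of_mem_inertia_of_nsmul_eq_zero hgood hpk (adicCompletionPrime_mem_primesAbove K w) hτ hk

/-- **Néron–Ogg–Shafarevich on `E_K[p]`**: at a place `w ∤ p` of good reduction `I_w` fixes every point of `E_K[p]`.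
[cite: SilvermanAEC2009, Prop. VII.4.1(a)] -/
theorem smul_torsion_eq_of_mem_inertia {w : HeightOneSpectrum (𝓞 K)}
    (hgood : (W.baseChange K).HasGoodReductionAt w) (hpw : ((p : ℕ) : 𝓞 K) ∉ w.asIdeal)
    {τ : absoluteGaloisGroup K} (hτ : τ ∈ GreenbergSelmer.inertia w)
    (Q : ↥((W.baseChange K).geomTorsion (p : ℤ))) : τ • Q = Q := by
  haveI hEK : (W.baseChange K).IsElliptic := inferInstanceAs (W.map (algebraMap ℚ K)).IsElliptic
  have e : GreenbergSelmer.inertia w = (adicCompletionPrime K w).inertia (absoluteGaloisGroup K) :=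
    (inertia_adicCompletionPrime_eq_map_absInertia K w).symm
  rw [e] at hτ
  exact (W.baseChange K).smul_geomTorsion_eq_of_mem_inertia hgood (n := (p : ℤ)) (by exact_mod_cast hpw)
    (adicCompletionPrime_mem_primesAbove K w) hτ Q

/-- Every element of `inertiaIn H w = H ⊓ I_w` (as a subgroup of `D_w`) fixes `E_K[p^∞]` at a good place `w ∤ p`.
[cite: SilvermanAEC2009, Prop. VII.4.1(a)] -/
theorem inertiaIn_smul_primaryTorsion_eq (H : Subgroup (absoluteGaloisGroup K)) {w : HeightOneSpectrum (𝓞 K)}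
    (hgood : (W.baseChange K).HasGoodReductionAt w) (hpw : ((p : ℕ) : 𝓞 K) ∉ w.asIdeal)
    (g : ↥(inertiaIn H w)) (x : ↥((W.baseChange K).geomPrimaryTorsion p)) : g • x = x := by
  have hg : ((g : GreenbergSelmer.decomp (K := K) w) : absoluteGaloisGroup K) ∈ GreenbergSelmer.inertia w :=
    ((mem_inertiaIn_iff H w g.1).mp g.2).2
  exact smul_primaryTorsion_eq_of_mem_inertia W hgood hpw hg x

/-- Every element of `inertiaIn H w` fixes `E_K[p]` at a good place `w ∤ p`. [cite: SilvermanAEC2009, Prop. VII.4.1(a)] -/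
theorem inertiaIn_smul_torsion_eq (H : Subgroup (absoluteGaloisGroup K)) {w : HeightOneSpectrum (𝓞 K)}
    (hgood : (W.baseChange K).HasGoodReductionAt w) (hpw : ((p : ℕ) : 𝓞 K) ∉ w.asIdeal)
    (g : ↥(inertiaIn H w)) (Q : ↥((W.baseChange K).geomTorsion (p : ℤ))) : g • Q = Q := by
  have hg : ((g : GreenbergSelmer.decomp (K := K) w) : absoluteGaloisGroup K) ∈ GreenbergSelmer.inertia w :=
    ((mem_inertiaIn_iff H w g.1).mp g.2).2
  exact smul_torsion_eq_of_mem_inertia W hgood hpw hg Q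

end NOS

/-! ## §3. The four (U) conjuncts -/

section Conjuncts

variable (W : WeierstrassCurve ℚ) [W.IsElliptic] {p : ℕ}
  {K : Type} [Field K] [NumberField K] (H : Subgroup (absoluteGaloisGroup K))
  (Sf : Finset (HeightOneSpectrum (𝓞 K)))

/-- **`hUi`: `H¹(H ⊓ I_w, Φ) → H¹(H ⊓ I_w, E_K[p])` is injective at every good `w ∉ Sf`, `w ∤ p`**, for every `Γ_K`-stable
`Φ ≤ E_K[p]` and every `H ≤ Γ_K` (e.g. `H = ker κ`): `I_w` acts trivially on `E_K[p]` (Néron–Ogg–Shafarevich).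
[cite: SilvermanAEC2009, Prop. VII.4.1(a)] [cite: KellerYin2024, Lemma 1.2.4 (arXiv:2402.12781v2 TeX L760–778)] -/
theorem injective_resH1Hom_inertiaIn_incl
    (hSf : ∀ w : HeightOneSpectrum (𝓞 K), w ∈ Sf ↔ ((W.conductorNorm ℤ : ℤ) : 𝓞 K) ∈ w.asIdeal)
    (Φ : StableSubgroup (absoluteGaloisGroup K) ↥((W.baseChange K).geomTorsion (p : ℤ)))
    (w : HeightOneSpectrum (𝓞 K)) (hw : w ∉ (↑Sf : Set (HeightOneSpectrum (𝓞 K))))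
    (hpw : ((p : ℕ) : 𝓞 K) ∉ w.asIdeal) :
    Function.Injective (resH1Hom (ContinuousMonoidHom.id (inertiaIn H w)) Φ.incl
      (fun g m ↦ Φ.incl_smul ((g : GreenbergSelmer.decomp (K := K) w) : absoluteGaloisGroup K) m)) :=
  CumulativeHeegnerInclusionAtThreeStubB1DevissageNamed.resH1Hom_id_injective_of_smul_eq Φ.incl _ Φ.incl_injective
    (inertiaIn_smul_torsion_eq W H (hasGoodReductionAt_of_not_mem W Sf hSf hw) hpw)

/-- **`hU₂`: `H¹(H ⊓ I_w, E_K[p]) → H¹(H ⊓ I_w, E_K[p^∞])` is injective at every good `w ∉ Sf`, `w ∤ p`**, for every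
`H ≤ Γ_K`: `I_w` acts trivially on `E_K[p^∞]`. [cite: SilvermanAEC2009, Prop. VII.4.1(a)] [cite: KellerYin2024, Lemma 1.2.4 (arXiv:2402.12781v2 TeX L760–778)] -/
theorem injective_resH1Hom_inertiaIn_inclusion
    (hSf : ∀ w : HeightOneSpectrum (𝓞 K), w ∈ Sf ↔ ((W.conductorNorm ℤ : ℤ) : 𝓞 K) ∈ w.asIdeal)
    (w : HeightOneSpectrum (𝓞 K)) (hw : w ∉ (↑Sf : Set (HeightOneSpectrum (𝓞 K))))
    (hpw : ((p : ℕ) : 𝓞 K) ∉ w.asIdeal) :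
    Function.Injective (resH1Hom (ContinuousMonoidHom.id (inertiaIn H w))
      (AddSubgroup.inclusion (geomTorsion_le_geomPrimaryTorsion (W.baseChange K) p))
      (fun (g : inertiaIn H w) (m : ↥((W.baseChange K).geomTorsion (p : ℤ))) ↦
        (rfl : (AddSubgroup.inclusion (geomTorsion_le_geomPrimaryTorsion (W.baseChange K) p))
            (((g : GreenbergSelmer.decomp (K := K) w) : absoluteGaloisGroup K) • m) =
          ((g : GreenbergSelmer.decomp (K := K) w) : absoluteGaloisGroup K) •
            (AddSubgroup.inclusion (geomTorsion_le_geomPrimaryTorsion (W.baseChange K) p)) m))) :=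
  CumulativeHeegnerInclusionAtThreeStubB1DevissageNamed.resH1Hom_id_injective_of_smul_eq _ _
    (AddSubgroup.inclusion_injective _)
    (inertiaIn_smul_primaryTorsion_eq W H (hasGoodReductionAt_of_not_mem W Sf hSf hw) hpw)

omit [W.IsElliptic] in
/-- **`hU₁` / `hU₃`: `H¹(H ⊓ I_w, N) → H¹(H ⊓ I_w, (F/𝒪)(θ))` is injective** for EVERY place `w`, every `H ≤ Γ_K`, every
Teichmüller character `θ` (`θ^{p−1} = 1`) and every equivariant embedding `j : N ↪ (F/𝒪)(θ)` onto the `p`-torsion (`N = Φ` with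
`θ = θsub`, `N = E_K[p]/Φ` with `θ = θquot`): the invariants of `(F/𝒪)(θ)` under any group acting through `Γ_K` are
`p`-divisible in themselves (`charModule_invariants_divisible`), so the Kummer criterion
`resH1Hom_id_injective_of_invariants_divisible` applies — no reduction hypothesis needed. [cite: KellerYin2024, Lemma 1.2.4 (arXiv:2402.12781v2 TeX L760–778)] -/
theorem injective_resH1Hom_inertiaIn_of_charModule [Fact p.Prime]
    (θ : FramedGaloisRep K (padicCoeffIntegers (∅ : Set (PadicAlgCl p))) 1)
    (hθ : ∀ σ : absoluteGaloisGroup K, θ σ ^ (p - 1) = 1)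
    {N : Type} [AddCommGroup N] [DistribMulAction (absoluteGaloisGroup K) N] [TopologicalSpace N]
    [DiscreteTopology N]
    (j : N →+ charModule (∅ : Set (PadicAlgCl p)) θ)
    (hj : ∀ (g : absoluteGaloisGroup K) (a : N), j (g • a) = g • j a) (hinj : Function.Injective j)
    (hrange : ∀ x : charModule (∅ : Set (PadicAlgCl p)) θ, x ∈ j.range ↔ p • x = 0)
    (w : HeightOneSpectrum (𝓞 K)) :
    Function.Injective (resH1Hom (ContinuousMonoidHom.id (inertiaIn H w)) j
      (fun g m ↦ hj ((g : GreenbergSelmer.decomp (K := K) w) : absoluteGaloisGroup K) m)) :=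
  CharResidualSelmerCount.resH1Hom_id_injective_of_invariants_divisible j _ hinj hrange
    (CharResidualSelmerCount.charModule_invariants_divisible θ hθ (G := ↥(inertiaIn H w))
      (fun g ↦ ((g : GreenbergSelmer.decomp (K := K) w) : absoluteGaloisGroup K)) (fun _ _ ↦ rfl))

end Conjuncts

end Summit.BirchSwinnertonDyer.BirchSwinnertonDyer.Theorems.IndexInputsH0

end
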